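/-
COR-CM (cell pub-hodgecm2, stage 2 of the Hodge ladder) — junction B01: the (β)-FREE END DISPLAYS AT THE APPENDIX-C DATUM ALONG `e ι₁` —
pin-3's team-facing along-junctions `Model.faceSupply_of_thm418AsPrinted_glue_treeCofan_along` / `…_glue_unif_along`
(`Transposition/Item6SupplyPinnedAssemblyAlong.lean`, p303619, pin-1/pin-2/pin-3 under own-htheta; TEAM hComp / TEAM hCMisogE fill their
slots BY NAME) COMPOSED BY NAME with the meeting-form display of the x2 lane (`CorCM/B01/FaceWedgeOverlapBypassMeeting.lean`, p295997;
lead NAMING RULING HOME/INBOX l.4194 (3), blanket `B01/FaceWedge*`).  Sequel of `CorCM/B01/FaceWedgeOverlapBypassMeetingPinned.lean`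
(p301318: the same for the E-rational junction `faceSupply_of_thm418AsPrinted_pinnedE_isog`).  Authored and filed by seat
prover-pub-hodgecm2-b01-x2-g7-0 (b01-x2 gen 7), 2026-08-21.  Theorems only (two one-line compositions, at the records of the universe of
record): no `def`, no instance, no cite binder, nothing cited as a record, nothing asserted, no `sorry`; no file of another lane is modified.
T5 (standing tribunal item, COORDINATOR RULING 2026-08-21T15:33:56Z (3)): the binder sets below (= the T5-checked along binders of
`Item6SupplyPinnedAssemblyAlong.lean` §1/§2, T5-LEDGER l.52 ∪ the T5-checked `hM`, T5-LEDGER l.16) were submitted to pub-hodgecm2-t5-consist-1 on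
the exact bytes before filing (HOME/INBOX; verdict line in HOME/T5-LEDGER.md, quoted in the filing note).
FRAMING (COORDINATOR RULING 2026-08-21T11:55:35Z): HC_CM is NOT proved; nothing below is an «S2 SUPPLY CLOSED» statement; every
displayed hypothesis is OPEN at a general face and inhabited by no one.
-/
import Summits.HodgeConjecture.CorCM.B01.Transposition.Item6SupplyPinnedAssemblyAlong
import Summits.HodgeConjecture.CorCM.B01.FaceWedgeOverlapBypassMeeting
import HarnessLib

/-!
# The along end display without `hD`: along binders + `hM` ⇒ `HC_CM`

pin-3's team-facing END DISPLAY `Model.hc_cm_of_thm418AsPrinted_glue_treeCofan_along (U) (hU) … (hD)` (p303619 §3) composes its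
along-junction §1 (`faceSupply_of_thm418AsPrinted_glue_treeCofan_along … : U.FaceSupply`) with
`Model.hc_cm_of_supply_of_dictionary_of_eq _ rfl … hD`, whose `hD` (`Transposition/Item6HoldsRec.lean`:211–226) binds (β)
`emb Γ' (cover^* x) = emb Γ x` — consistent, but FALSE at the tree's only model embedding `Model.embOf` (b01-idea-2 g19 IDEA-2t; stage-1
hazard C1; red team TGTBT §6 (i) RULING OF RECORD «(β) STRONGER-THAN-CONSUMED; consumed forms `hM` ∕ `hLM` ∕ nothing»): no tree
construction can inhabit it.  THIS FILE composes BOTH along-junctions BY NAME with the (β)-free meeting-form display of the x2 lane instead: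
* `hc_cm_of_thm418AsPrinted_glue_treeCofan_along_settingMeetSat_rec` — along binders of §1 (Shimura side by a cofan of TREE surfaces
  {`hTree`, `hAlb`}) + `hM` (ONE isolation setting per context over `Lp ℂ 2 V.autMeasure`, C5′ at SATURATED (12)-sets, C6′;
  `FaceWedgeOverlapBypassMeeting.lean`), at the four `_holds` records + `deligneMilne1982_Thm_6_20_full_holds`;
* `hc_cm_of_thm418AsPrinted_glue_unif_along_settingMeetSat_rec` — along binders of §2 (Shimura side from pin-1's {`hUnif`, `hAlb`}:
  pieces with explicit ball data — the display both teams meet, b28 §T20/§T21) + `hM`, likewise.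
RESIDUAL BINDERS = EXACTLY the along binders {`e`, `P5`, `iso`, `C`, `R`, `hLiu`, `hObj`, `hChi`, `hirr`, `hsm`, `hμσ`, `hCMisogσ`,
`hTree` ∕ `hUnif`, `hAlb`} (their classification: `Item6SupplyPinnedAssemblyAlong.lean` module docstring, pin-1/pin-2/pin-3 lines, TEAM
hComp / TEAM hCMisogE tables, the red-team DELTA audits; `hirr` carries the D6.3 over-tag of AUDIT-CITESCOPE as in every descendant of the
pinned junction) + `hM` (its: `FaceWedgeOverlapBypassMeeting.lean` module docstring: (v-S)/C6′/pinned C5′ PKG-GENERAL per configuration,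
C5′-at-saturation = (E) + TRAP T2; B01-O of record ⟺ `FaceMeetCoupling(U_rec)`, sandwich `FaceWedgeOverlapMeetingVacuity.lean` p301274).
No `HG/emb/cover`, no (α)(β)(γ), no `levelMeet`, no `TranslateClosed`; item (iii) = `Model.embOf` + D2; B01-H =
`Transposition.Model.heckeWedge10_of_heckeFamily`.  The embedding family `e` stays FREE (package P1 `e := fun _ ι₁ ↦ ι₁`; package P2′ ∕
TEAM hComp's route (B) `e := fun _ ι₁ ↦ (starRingEnd ℂ).toRingHom.comp ι₁`); the `hEP` (per-pair ∕ exhaustion) variants are the same one-line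
compositions with `hc_cm_of_supply_of_exhaustion_pairSettingMeet_embOf` and are not spelled out.
HC_CM is NOT proved: none of these hypotheses is inhabited; count-neutral alternative readings, no row change.
-/

noncomputable section

set_option autoImplicit false

open scoped TensorProduct InnerProductSpace

namespace Summit.HodgeConjecture.CorCM.Model

open CategoryTheory CategoryTheory.Limits AlgebraicGeometry NumberField MeasureTheory
open Literature.AlgebraicGeometry.Motives
open Literature.AlgebraicGeometry.Motives.HodgeStructure (conj)
open Literature.AlgebraicGeometry.HodgeTheory
open Literature.AlgebraicGeometry.ShimuraVarieties
open Literature.AlgebraicGeometry.ComplexMultiplication (IsCMTypeRealisation)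
open Literature.NumberTheory.ComplexMultiplication
open Literature.NumberTheory.Automorphic
open Literature.NumberTheory.Automorphic.IdeleClassGroup
open Literature.NumberTheory.Automorphic.PicardCM
open Literature.NumberTheory.Automorphic.Liu2021
open Literature.NumberTheory.Automorphic.Liu2021.AppendixC
open Prior.Perl34File (Perl34.IsolationSetting)
open Prior.Perl34File.Perl34

/-! ## §1  The along-junction by TREE SURFACES {`hTree`, `hAlb`} + `hM` -/

/-- **(β)-FREE END DISPLAY AT THE APPENDIX-C DATUM ALONG `e ι₁`, SATURATED MEETING FORM, on the universe OF RECORD**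
(`exists_isReal_hodgeModel_holds`, `hodgePQ_independent_of_hodgeModel_holds`, `BallQuotient.ballQuotientUniformised_holds`,
`cmAbelianVarietyRealised_holds`, `deligneMilne1982_Thm_6_20_full_holds` plugged in; `let U := U_rec`, `let hU := …` for legibility):
pin-3's along-junction `faceSupply_of_thm418AsPrinted_glue_treeCofan_along` (`Transposition/Item6SupplyPinnedAssemblyAlong.lean` §1; its
fourteen binders `e … hAlb` VERBATIM, in its order, `hTree` printed at the records exactly as in its §3) composed BY NAME with
`hc_cm_of_supply_of_settingMeetSat_embOf` (`FaceWedgeOverlapBypassMeeting.lean`; binder `hM` VERBATIM at `U_rec`, = hypothesis #2 of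
`hc_cm_of_supply_of_settingMeetSat_embOf_rec`).  Displayed hypotheses = EXACTLY {`e`, `P5`, `iso`, `C`, `R`, `hLiu`, `hObj`, `hChi`,
`hirr`, `hsm`, `hμσ`, `hCMisogσ`, `hTree`, `hAlb`} + `hM`; compare `hc_cm_of_thm418AsPrinted_glue_treeCofan_along _ rfl … hD` (§3 there):
no `HG/emb/cover`, no (α)(β)(γ).  HC_CM is NOT proved: `hCMisogσ`, `hTree`, `hAlb`, `hM` are inhabited by no one here. [folklore] -/
theorem hc_cm_of_thm418AsPrinted_glue_treeCofan_along_settingMeetSat_rec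
    (e : ∀ (F : CMField), (F →+* ℂ) → (F →+* ℂ))
    (P5 : ∀ (F : CMField) (ι₁ : F →+* ℂ) (_ : HermSpace3 F ι₁) (_ : CMType F), PropC5Data (maximalRealSubfield F) F)
    (iso : ∀ (F : CMField) (ι₁ : F →+* ℂ) (_ : HermSpace3 F ι₁) (_ : CMType F), ℕ → Prop)
    (C : ∀ (F : CMField) (ι₁ : F →+* ℂ) (V : HermSpace3 F ι₁) (Φ : CMType F), Sec42Data (P5 F ι₁ V Φ) (iso F ι₁ V Φ))
    (R : ∀ (F : CMField) (ι₁ : F →+* ℂ) (V : HermSpace3 F ι₁) (Φ : CMType F), Thm418Rest (C F ι₁ V Φ))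
    (hLiu : ∀ (F : CMField), IsGalois ℚ F → 6 ≤ Module.finrank ℚ F → ∀ (Φ : CMType F) (ι₁ : F →+* ℂ), ι₁ ∈ Φ.1 →
      ∀ V : HermSpace3 F ι₁, Thm418AsPrinted (toThm418Data (C F ι₁ V Φ) (R F ι₁ V Φ)))
    (hObj : ∀ (F : CMField), IsGalois ℚ F → 6 ≤ Module.finrank ℚ F → ∀ (Φ : CMType F) (ι₁ : F →+* ℂ), ι₁ ∈ Φ.1 →
      ∀ V : HermSpace3 F ι₁, Nonempty (toThm418Data (C F ι₁ V Φ) (R F ι₁ V Φ)).Obj)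
    (hChi : ∀ (F : CMField), IsGalois ℚ F → 6 ≤ Module.finrank ℚ F → ∀ (Φ : CMType F) (ι₁ : F →+* ℂ), ι₁ ∈ Φ.1 →
      ∀ V : HermSpace3 F ι₁, Nonempty (toThm418Data (C F ι₁ V Φ) (R F ι₁ V Φ)).Chi)
    (hirr : ∀ (F : CMField), IsGalois ℚ F → 6 ≤ Module.finrank ℚ F → ∀ (Φ : CMType F) (ι₁ : F →+* ℂ), ι₁ ∈ Φ.1 →
      ∀ (V : HermSpace3 F ι₁) (i : (toThm418Data (C F ι₁ V Φ) (R F ι₁ V Φ)).AdmIndex), ((toThm418Data (C F ι₁ V Φ) (R F ι₁ V Φ)).rhoAt i).IsIrreducible)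
    (hsm : ∀ (F : CMField), IsGalois ℚ F → 6 ≤ Module.finrank ℚ F → ∀ (Φ : CMType F) (ι₁ : F →+* ℂ), ι₁ ∈ Φ.1 →
      ∀ (V : HermSpace3 F ι₁) (i : (toThm418Data (C F ι₁ V Φ) (R F ι₁ V Φ)).AdmIndex) (v : (toThm418Data (C F ι₁ V Φ) (R F ι₁ V Φ)).omegaAt i),
        ∃ S : Subgroup (toThm418Data (C F ι₁ V Φ) (R F ι₁ V Φ)).G, IsOpen (S : Set (toThm418Data (C F ι₁ V Φ) (R F ι₁ V Φ)).G) ∧ ∀ k ∈ S, (toThm418Data (C F ι₁ V Φ) (R F ι₁ V Φ)).rhoAt i k v = v)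
    (hμσ : ∀ (F : CMField), IsGalois ℚ F → 6 ≤ Module.finrank ℚ F → ∀ (Φ : CMType F) (ι₁ : F →+* ℂ), ι₁ ∈ Φ.1 →
      ∀ (V : HermSpace3 F ι₁) (g : F ≃ₐ[ℚ] F),
        (e F ι₁).comp (g : F →+* F) ∈ (toThm418Data (C F ι₁ V Φ) (R F ι₁ V Φ)).cmType.1 ↔ (e F ι₁).comp (g.symm : F →+* F) ∈ Φ.1)
    (hCMisogσ : ∀ (F : CMField) [IsGalois ℚ F], 6 ≤ Module.finrank ℚ F → ∀ (Φ : CMType F) (ι₁ : F →+* ℂ), ι₁ ∈ Φ.1 →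
      ∀ (V : HermSpace3 F ι₁) (Dμ : (toThm418Data (C F ι₁ V Φ) (R F ι₁ V Φ)).Obj),
        haveI := (toThm418Data (C F ι₁ V Φ) (R F ι₁ V Φ)).isConjugateSymplectic.numberField_muAlgValueField
        ∀ incl : reflexField ℚ F (algValuedIn (e F ι₁) (toThm418Data (C F ι₁ V Φ) (R F ι₁ V Φ)).cmType.1) →+* muAlgValueField F (toThm418Data (C F ι₁ V Φ) (R F ι₁ V Φ)).μ,
          (∀ k : reflexField ℚ F (algValuedIn (e F ι₁) (toThm418Data (C F ι₁ V Φ) (R F ι₁ V Φ)).cmType.1),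
            ((incl k : muAlgValueField F (toThm418Data (C F ι₁ V Φ) (R F ι₁ V Φ)).μ) : ℂ) = e F ι₁ k) →
          ∃ (B : AbelianVariety ℂ) (g : (letI := (e F ι₁).toAlgebra; ((R F ι₁ V Φ).Aμ Dμ).baseChange ℂ) ⟶ B), AbelianVariety.IsIsogeny g ∧
            ∃ (ιB : 𝓞 (muAlgValueField F (toThm418Data (C F ι₁ V Φ) (R F ι₁ V Φ)).μ) →+* End B)
              (θB : muAlgValueField F (toThm418Data (C F ι₁ V Φ) (R F ι₁ V Φ)).μ →+* Module.End ℂ (complexBetti B.X 1)),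
              IsCMTypeRealisation (inducedCMType incl (reflexCMType (e F ι₁) (toThm418Data (C F ι₁ V Φ) (R F ι₁ V Φ)).cmType (AlgHom.id ℚ F))) B ιB θB)
    (hTree : ∀ (F : CMField), IsGalois ℚ F → 6 ≤ Module.finrank ℚ F → ∀ (Φ : CMType F) (ι₁ : F →+* ℂ), ι₁ ∈ Φ.1 →
      ∀ (V : HermSpace3 F ι₁) (τ : maximalRealSubfield F →+* ℝ), C5.IsAbove τ (e F ι₁) →
        ∃ Ksm : Subgroup (P5 F ι₁ V Φ).G, IsOpenCompact Ksm ∧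
          ∀ K : C5.OpenCompactSubgroup (P5 F ι₁ V Φ).G, K.1 ≤ Ksm →
            ∃ (Cset : Type) (_ : Fintype Cset) (Γ : Cset → Level V)
              (inj : ∀ c, Var.scheme (ballQuotientUniformisedDatum_of BallQuotient.ballQuotientUniformised_holds)
                cmAbelianVarietyRealised_holds (.pms (pmsCode F ι₁ V (Γ c))) ⟶
                (baseChangeHom (e F ι₁).fieldRange.subtype).obj
                  (((P5 F ι₁ V Φ).Sh τ (e F ι₁)).obj (C5.OpenCompactSubgroup.transport ((P5 F ι₁ V Φ).fix τ) K))),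
              Nonempty (IsColimit (Cofan.mk _ inj)))
    (hAlb : ∀ (F : CMField), IsGalois ℚ F → 6 ≤ Module.finrank ℚ F → ∀ (Φ : CMType F) (ι₁ : F →+* ℂ), ι₁ ∈ Φ.1 →
      ∀ (V : HermSpace3 F ι₁) (K' : C5.SmallLevel (C F ι₁ V Φ).S.K₀) (Cset : Type) (_ : Fintype Cset) (X : Cset → SchemeOver ℂ)
        (inj : ∀ c, X c ⟶ (baseChangeHom (e F ι₁)).obj ((C F ι₁ V Φ).X K')),
        (∀ c, IsSmoothProjective 2 (X c)) → Nonempty (IsColimit (Cofan.mk _ inj)) →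
          ∃ (𝒥 : ∀ c, Jacobian (X c)) (π : ∀ c, (letI := (e F ι₁).toAlgebra; ((C F ι₁ V Φ).A K').baseChange ℂ) ⟶ (𝒥 c).J),
            Nonempty (IsLimit (Fan.mk (letI := (e F ι₁).toAlgebra; ((C F ι₁ V Φ).A K').baseChange ℂ) π))) :
    let U := picardCMUniverse exists_isReal_hodgeModel_holds hodgePQ_independent_of_hodgeModel_holds
      BallQuotient.ballQuotientUniformised_holds cmAbelianVarietyRealised_holds
    let hU := ballQuotientUniformisedDatum_of BallQuotient.ballQuotientUniformised_holds
    (∀ (F : CMField), IsGalois ℚ F → 6 ≤ Module.finrank ℚ F → ∀ (f : Face F) (ι₁ : F →+* ℂ), f.Admissible ι₁ →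
      ∀ V : HermSpace3 F ι₁,
      ∃ (H CG G SK SigIdx SigIdxG : Type) (_ : NormedAddCommGroup H) (_ : InnerProductSpace ℂ H) (_ : CompleteSpace H)
        (_ : NormedAddCommGroup CG) (_ : NormedSpace ℂ CG) (_ : Group G) (_ : TopologicalSpace G) (_ : TopologicalSpace SK)
        (S : Perl34.IsolationSetting H (Lp ℂ 2 V.autMeasure) CG G SK SigIdx SigIdxG),
        (∀ (Γ : Level V) (ω₁ ω₂ : U.CohC (U.pms F ι₁ V Γ) 1),
          ω₁ ∈ U.Uiso Γ F (f.psi 0) ι₁ → ω₂ ∈ U.Uiso Γ F (f.psi 1) ι₁ →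
            embOf exists_isReal_hodgeModel_holds hodgePQ_independent_of_hodgeModel_holds hU cmAbelianVarietyRealised_holds Γ
                (U.cup2C (U.pms F ι₁ V Γ) 1 ω₁ ω₂) ≠ 0 →
              ∃ u ∈ S.t12.S12,
                ⟪embOf exists_isReal_hodgeModel_holds hodgePQ_independent_of_hodgeModel_holds hU cmAbelianVarietyRealised_holds Γ
                    (U.cup2C (U.pms F ι₁ V Γ) 1 ω₁ ω₂), u⟫_ℂ ≠ 0) ∧
        (∀ χ : S.t34.X, S.t34.allowed χ → ∀ (Φ : SK) (Γ₁ : Level V)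
          (ω₁ ω₂ : U.CohC (U.pms F ι₁ V Γ₁) 1),
          ω₁ ∈ U.Uiso Γ₁ F (f.psi 0) ι₁ →
          ω₂ ∈ U.Uiso Γ₁ F (f.psi 1) ι₁ →
            ⟪embOf exists_isReal_hodgeModel_holds hodgePQ_independent_of_hodgeModel_holds hU cmAbelianVarietyRealised_holds Γ₁
                (U.cup2C (U.pms F ι₁ V Γ₁) 1 ω₁ ω₂),
              S.t34.ϑ χ Φ⟫_ℂ ≠ 0 →
              ∃ (Γ : Level V) (ω : Fin 4 → U.CohC (U.pms F ι₁ V Γ) 1),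
                (∀ i, ω i ∈ U.Uiso Γ F (f.psi i) ι₁) ∧
                  ⟪embOf exists_isReal_hodgeModel_holds hodgePQ_independent_of_hodgeModel_holds hU cmAbelianVarietyRealised_holds Γ
                      (U.cup2C (U.pms F ι₁ V Γ) 1 (ω 2) (ω 3)),
                    embOf exists_isReal_hodgeModel_holds hodgePQ_independent_of_hodgeModel_holds hU cmAbelianVarietyRealised_holds Γ
                      (U.cup2C (U.pms F ι₁ V Γ) 1 (ω 0) (ω 1))⟫_ℂ
                    ≠ 0)) →
    HC_CM :=
  fun hM ↦ hc_cm_of_supply_of_settingMeetSat_embOf exists_isReal_hodgeModel_holds hodgePQ_independent_of_hodgeModel_holds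
    BallQuotient.ballQuotientUniformised_holds cmAbelianVarietyRealised_holds deligneMilne1982_Thm_6_20_full_holds
    (faceSupply_of_thm418AsPrinted_glue_treeCofan_along _ _ _ _ e P5 iso C R hLiu hObj hChi hirr hsm hμσ hCMisogσ hTree hAlb) hM

/-! ## §2  The along-junction by pin-1's {`hUnif`, `hAlb`} + `hM` — the display both teams meet (b28 §T20/§T21) -/

/-- **(β)-FREE END DISPLAY AT THE APPENDIX-C DATUM ALONG `e ι₁`, SATURATED MEETING FORM, on the universe OF RECORD, Shimura side from
{`hUnif`, `hAlb`}**: pin-3's `faceSupply_of_thm418AsPrinted_glue_unif_along` (`Item6SupplyPinnedAssemblyAlong.lean` §2; its fourteen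
binders `e … hAlb` VERBATIM, in its order) composed BY NAME with `hc_cm_of_supply_of_settingMeetSat_embOf` (binder `hM` VERBATIM at
`U_rec`).  Displayed hypotheses = EXACTLY {`e`, `P5`, `iso`, `C`, `R`, `hLiu`, `hObj`, `hChi`, `hirr`, `hsm`, `hμσ`, `hCMisogσ`, `hUnif`,
`hAlb`} + `hM`; at `e := fun _ ι₁ ↦ (starRingEnd ℂ).toRingHom.comp ι₁` (package P2′; TEAM hComp's WORD route (B), HOME/INBOX
2026-08-21T21:14:01Z) the slots `hUnif`/`hAlb`/`hCMisogσ` are the ones TEAM hComp's `hUnif_holds`/`hAlb_holds` and TEAM hCMisogE's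
σ-parametric Def. 4.5 (2) reading fill BY NAME.  No `hD`.  HC_CM is NOT proved: `hCMisogσ`, `hUnif`, `hAlb`, `hM` are inhabited by no
one here. [folklore] -/
theorem hc_cm_of_thm418AsPrinted_glue_unif_along_settingMeetSat_rec
    (e : ∀ (F : CMField), (F →+* ℂ) → (F →+* ℂ))
    (P5 : ∀ (F : CMField) (ι₁ : F →+* ℂ) (_ : HermSpace3 F ι₁) (_ : CMType F), PropC5Data (maximalRealSubfield F) F)
    (iso : ∀ (F : CMField) (ι₁ : F →+* ℂ) (_ : HermSpace3 F ι₁) (_ : CMType F), ℕ → Prop)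
    (C : ∀ (F : CMField) (ι₁ : F →+* ℂ) (V : HermSpace3 F ι₁) (Φ : CMType F), Sec42Data (P5 F ι₁ V Φ) (iso F ι₁ V Φ))
    (R : ∀ (F : CMField) (ι₁ : F →+* ℂ) (V : HermSpace3 F ι₁) (Φ : CMType F), Thm418Rest (C F ι₁ V Φ))
    (hLiu : ∀ (F : CMField), IsGalois ℚ F → 6 ≤ Module.finrank ℚ F → ∀ (Φ : CMType F) (ι₁ : F →+* ℂ), ι₁ ∈ Φ.1 →
      ∀ V : HermSpace3 F ι₁, Thm418AsPrinted (toThm418Data (C F ι₁ V Φ) (R F ι₁ V Φ)))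
    (hObj : ∀ (F : CMField), IsGalois ℚ F → 6 ≤ Module.finrank ℚ F → ∀ (Φ : CMType F) (ι₁ : F →+* ℂ), ι₁ ∈ Φ.1 →
      ∀ V : HermSpace3 F ι₁, Nonempty (toThm418Data (C F ι₁ V Φ) (R F ι₁ V Φ)).Obj)
    (hChi : ∀ (F : CMField), IsGalois ℚ F → 6 ≤ Module.finrank ℚ F → ∀ (Φ : CMType F) (ι₁ : F →+* ℂ), ι₁ ∈ Φ.1 →
      ∀ V : HermSpace3 F ι₁, Nonempty (toThm418Data (C F ι₁ V Φ) (R F ι₁ V Φ)).Chi)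
    (hirr : ∀ (F : CMField), IsGalois ℚ F → 6 ≤ Module.finrank ℚ F → ∀ (Φ : CMType F) (ι₁ : F →+* ℂ), ι₁ ∈ Φ.1 →
      ∀ (V : HermSpace3 F ι₁) (i : (toThm418Data (C F ι₁ V Φ) (R F ι₁ V Φ)).AdmIndex), ((toThm418Data (C F ι₁ V Φ) (R F ι₁ V Φ)).rhoAt i).IsIrreducible)
    (hsm : ∀ (F : CMField), IsGalois ℚ F → 6 ≤ Module.finrank ℚ F → ∀ (Φ : CMType F) (ι₁ : F →+* ℂ), ι₁ ∈ Φ.1 →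
      ∀ (V : HermSpace3 F ι₁) (i : (toThm418Data (C F ι₁ V Φ) (R F ι₁ V Φ)).AdmIndex) (v : (toThm418Data (C F ι₁ V Φ) (R F ι₁ V Φ)).omegaAt i),
        ∃ S : Subgroup (toThm418Data (C F ι₁ V Φ) (R F ι₁ V Φ)).G, IsOpen (S : Set (toThm418Data (C F ι₁ V Φ) (R F ι₁ V Φ)).G) ∧ ∀ k ∈ S, (toThm418Data (C F ι₁ V Φ) (R F ι₁ V Φ)).rhoAt i k v = v)
    (hμσ : ∀ (F : CMField), IsGalois ℚ F → 6 ≤ Module.finrank ℚ F → ∀ (Φ : CMType F) (ι₁ : F →+* ℂ), ι₁ ∈ Φ.1 →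
      ∀ (V : HermSpace3 F ι₁) (g : F ≃ₐ[ℚ] F),
        (e F ι₁).comp (g : F →+* F) ∈ (toThm418Data (C F ι₁ V Φ) (R F ι₁ V Φ)).cmType.1 ↔ (e F ι₁).comp (g.symm : F →+* F) ∈ Φ.1)
    (hCMisogσ : ∀ (F : CMField) [IsGalois ℚ F], 6 ≤ Module.finrank ℚ F → ∀ (Φ : CMType F) (ι₁ : F →+* ℂ), ι₁ ∈ Φ.1 →
      ∀ (V : HermSpace3 F ι₁) (Dμ : (toThm418Data (C F ι₁ V Φ) (R F ι₁ V Φ)).Obj),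
        haveI := (toThm418Data (C F ι₁ V Φ) (R F ι₁ V Φ)).isConjugateSymplectic.numberField_muAlgValueField
        ∀ incl : reflexField ℚ F (algValuedIn (e F ι₁) (toThm418Data (C F ι₁ V Φ) (R F ι₁ V Φ)).cmType.1) →+* muAlgValueField F (toThm418Data (C F ι₁ V Φ) (R F ι₁ V Φ)).μ,
          (∀ k : reflexField ℚ F (algValuedIn (e F ι₁) (toThm418Data (C F ι₁ V Φ) (R F ι₁ V Φ)).cmType.1),
            ((incl k : muAlgValueField F (toThm418Data (C F ι₁ V Φ) (R F ι₁ V Φ)).μ) : ℂ) = e F ι₁ k) →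
          ∃ (B : AbelianVariety ℂ) (g : (letI := (e F ι₁).toAlgebra; ((R F ι₁ V Φ).Aμ Dμ).baseChange ℂ) ⟶ B), AbelianVariety.IsIsogeny g ∧
            ∃ (ιB : 𝓞 (muAlgValueField F (toThm418Data (C F ι₁ V Φ) (R F ι₁ V Φ)).μ) →+* End B)
              (θB : muAlgValueField F (toThm418Data (C F ι₁ V Φ) (R F ι₁ V Φ)).μ →+* Module.End ℂ (complexBetti B.X 1)),
              IsCMTypeRealisation (inducedCMType incl (reflexCMType (e F ι₁) (toThm418Data (C F ι₁ V Φ) (R F ι₁ V Φ)).cmType (AlgHom.id ℚ F))) B ιB θB)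
    (hUnif : ∀ (F : CMField), IsGalois ℚ F → 6 ≤ Module.finrank ℚ F → ∀ (Φ : CMType F) (ι₁ : F →+* ℂ), ι₁ ∈ Φ.1 →
      ∀ (V : HermSpace3 F ι₁) (τ : maximalRealSubfield F →+* ℝ), C5.IsAbove τ (e F ι₁) →
        ∃ Ksm : Subgroup (P5 F ι₁ V Φ).G, IsOpenCompact Ksm ∧
          ∀ K : C5.OpenCompactSubgroup (P5 F ι₁ V Φ).G, K.1 ≤ Ksm →
            ∃ (Cset : Type) (_ : Fintype Cset) (X : Cset → SchemeOver ℂ) (B : ∀ c, UnitaryBallUniformisationDatum 2 (X c))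
              (Γ : Cset → Level V)
              (inj : ∀ c, X c ⟶ (baseChangeHom (e F ι₁).fieldRange.subtype).obj
                (((P5 F ι₁ V Φ).Sh τ (e F ι₁)).obj (C5.OpenCompactSubgroup.transport ((P5 F ι₁ V Φ).fix τ) K))),
              (∀ c, (B c).Hℂ = V.Hm.map ι₁) ∧
              (∀ c, (B c).Γ.map (Matrix.GeneralLinearGroup.map (B c).τ₁) =
                (Γ c).Γ.map (Matrix.GeneralLinearGroup.map ι₁)) ∧
              Nonempty (IsColimit (Cofan.mk _ inj)))
    (hAlb : ∀ (F : CMField), IsGalois ℚ F → 6 ≤ Module.finrank ℚ F → ∀ (Φ : CMType F) (ι₁ : F →+* ℂ), ι₁ ∈ Φ.1 →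
      ∀ (V : HermSpace3 F ι₁) (K' : C5.SmallLevel (C F ι₁ V Φ).S.K₀) (Cset : Type) (_ : Fintype Cset) (X : Cset → SchemeOver ℂ)
        (inj : ∀ c, X c ⟶ (baseChangeHom (e F ι₁)).obj ((C F ι₁ V Φ).X K')),
        (∀ c, IsSmoothProjective 2 (X c)) → Nonempty (IsColimit (Cofan.mk _ inj)) →
          ∃ (𝒥 : ∀ c, Jacobian (X c)) (π : ∀ c, (letI := (e F ι₁).toAlgebra; ((C F ι₁ V Φ).A K').baseChange ℂ) ⟶ (𝒥 c).J),
            Nonempty (IsLimit (Fan.mk (letI := (e F ι₁).toAlgebra; ((C F ι₁ V Φ).A K').baseChange ℂ) π))) :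
    let U := picardCMUniverse exists_isReal_hodgeModel_holds hodgePQ_independent_of_hodgeModel_holds
      BallQuotient.ballQuotientUniformised_holds cmAbelianVarietyRealised_holds
    let hU := ballQuotientUniformisedDatum_of BallQuotient.ballQuotientUniformised_holds
    (∀ (F : CMField), IsGalois ℚ F → 6 ≤ Module.finrank ℚ F → ∀ (f : Face F) (ι₁ : F →+* ℂ), f.Admissible ι₁ →
      ∀ V : HermSpace3 F ι₁,
      ∃ (H CG G SK SigIdx SigIdxG : Type) (_ : NormedAddCommGroup H) (_ : InnerProductSpace ℂ H) (_ : CompleteSpace H)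
        (_ : NormedAddCommGroup CG) (_ : NormedSpace ℂ CG) (_ : Group G) (_ : TopologicalSpace G) (_ : TopologicalSpace SK)
        (S : Perl34.IsolationSetting H (Lp ℂ 2 V.autMeasure) CG G SK SigIdx SigIdxG),
        (∀ (Γ : Level V) (ω₁ ω₂ : U.CohC (U.pms F ι₁ V Γ) 1),
          ω₁ ∈ U.Uiso Γ F (f.psi 0) ι₁ → ω₂ ∈ U.Uiso Γ F (f.psi 1) ι₁ →
            embOf exists_isReal_hodgeModel_holds hodgePQ_independent_of_hodgeModel_holds hU cmAbelianVarietyRealised_holds Γ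
                (U.cup2C (U.pms F ι₁ V Γ) 1 ω₁ ω₂) ≠ 0 →
              ∃ u ∈ S.t12.S12,
                ⟪embOf exists_isReal_hodgeModel_holds hodgePQ_independent_of_hodgeModel_holds hU cmAbelianVarietyRealised_holds Γ
                    (U.cup2C (U.pms F ι₁ V Γ) 1 ω₁ ω₂), u⟫_ℂ ≠ 0) ∧
        (∀ χ : S.t34.X, S.t34.allowed χ → ∀ (Φ : SK) (Γ₁ : Level V)
          (ω₁ ω₂ : U.CohC (U.pms F ι₁ V Γ₁) 1),
          ω₁ ∈ U.Uiso Γ₁ F (f.psi 0) ι₁ →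
          ω₂ ∈ U.Uiso Γ₁ F (f.psi 1) ι₁ →
            ⟪embOf exists_isReal_hodgeModel_holds hodgePQ_independent_of_hodgeModel_holds hU cmAbelianVarietyRealised_holds Γ₁
                (U.cup2C (U.pms F ι₁ V Γ₁) 1 ω₁ ω₂),
              S.t34.ϑ χ Φ⟫_ℂ ≠ 0 →
              ∃ (Γ : Level V) (ω : Fin 4 → U.CohC (U.pms F ι₁ V Γ) 1),
                (∀ i, ω i ∈ U.Uiso Γ F (f.psi i) ι₁) ∧
                  ⟪embOf exists_isReal_hodgeModel_holds hodgePQ_independent_of_hodgeModel_holds hU cmAbelianVarietyRealised_holds Γ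
                      (U.cup2C (U.pms F ι₁ V Γ) 1 (ω 2) (ω 3)),
                    embOf exists_isReal_hodgeModel_holds hodgePQ_independent_of_hodgeModel_holds hU cmAbelianVarietyRealised_holds Γ
                      (U.cup2C (U.pms F ι₁ V Γ) 1 (ω 0) (ω 1))⟫_ℂ
                    ≠ 0)) →
    HC_CM :=
  fun hM ↦ hc_cm_of_supply_of_settingMeetSat_embOf exists_isReal_hodgeModel_holds hodgePQ_independent_of_hodgeModel_holds
    BallQuotient.ballQuotientUniformised_holds cmAbelianVarietyRealised_holds deligneMilne1982_Thm_6_20_full_holds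
    (faceSupply_of_thm418AsPrinted_glue_unif_along _ _ _ _ e P5 iso C R hLiu hObj hChi hirr hsm hμσ hCMisogσ hUnif hAlb) hM

#print axioms hc_cm_of_thm418AsPrinted_glue_treeCofan_along_settingMeetSat_rec
#print axioms hc_cm_of_thm418AsPrinted_glue_unif_along_settingMeetSat_rec

end Summit.HodgeConjecture.CorCM.Model

end
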